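import Summits.QuantumFields.YangMills.Theorems.BalabanUVNodesN09RegularityTowerOfGeometricChartData

/-!
# NODE N09 · K0e's (2.9)-KEYED ON-DOMAIN β-VERSION PROVISO AT THE SMALL-FIELD DOMAINS OF RECORD, AND THE `∀ P` DOORS, FROM GEOMETRIC CHART DATA

Cell `pub-ymgap` (YM-PLAN Track A), DAG node N09 [Balaban1987RG1] (= [I]); seat `pub-ymgap-dag-n09-w1` g5 (D-0149 width seat 1 of node N09), FILE 6; count-neutral K1-face
helper keyed to K1⁸ `StabilityBRunRowsAtRecordR13SepCoPH` = stmt-QuantumFields-26907 (`--kind proof --supports … --as helper`).  HONEST FRAMING: kernel bookkeeping BY NAME over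
FILE 5; NOTHING of Bałaban's analysis asserted; every chart datum DISPLAYED ((M3r) stays UNOWNED); N09 NOT discharged; K0⁷∕K1⁸ NOT closed; counts unmoved (typed 28∕28 ·
discharged 5∕27); one finite 𝕋⁴ programme at fixed ε — R4 closes the conditional rung `BalabanLadder.UV` only; the Yang–Mills mass gap (Clay) is NOT proved by any of this;
nothing continuum ∕ ℝ⁴ ∕ OS.

WHY.  (a) K0e's `Node00.SmallFieldChi29OfRecord` §4 OFFERED the χ-generic on-domain β-version proviso `HasContTransportAlongOnχ T χ dom` («at every torus, history and step
`k < K` the β-input has a transform of record with a version continuous ON `dom K g (k+1)`», (0.13) p. 254 ∕ p. 259) and priced its (2.9)-keyed discharge as the (F1) PROGRAMME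
(`F1-PROGRAMME-DESIGN.md`: «`hasContTransportAlongDom29_of_N07`», M1–M4).  FILE 5 (`…N09RegularityTowerOfGeometricChartData`) delivers, per torus and history, `hreg_j` for all
`j < K` from GEOMETRIC chart data; §1–§2 below read that as the proviso itself — per `(K, g)` (`HasContTransportOn` at every step) and, given chart data for EVERY `(K, g)`,
the full `HasContTransportAlongOnχ (TcanOfRecord) (chiFixed29 ν ε₁) (fun K _ k => domAltOfRecord ν K k)` — i.e. the programme's target at the record's small-field domains,
MODULO the charts (M3∕M4's construction, displayed), N07 (`hcrit`, `hsolν`), (I19) and numerics.  (b) dag-n24-c's consumers read N09's member in the `∀ P` shape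
(`…N09TwoRadiiDoorForall`); §3 packages FILE 5's door run by run, and with the run-indexed leaf `h12` the node's `Dag.B12_main` at every run.

WHAT IS PROVED (theorems only; 0 def; 0 sorry; axioms standard).
* §1 ★★ `hasContTransportOn_all_of_geometricChartData` (per `(K, g)`: `∀ j < K, HasContTransportOn F N K j ρ_j (domAltOfRecord ν K (j+1))` — K0e's one-density on-domain
  proviso, `Node00.Record12ContT`, from FILE 5's `hreg_j` by `hasContVersionOn_regSet.mono`).
* §2 ★★★ `hasContTransportAlongOnχ_domAlt_of_geometricChartData` (chart data for every `(K, g)` ⇒ `HasContTransportAlongOnχ F N (TcanOfRecord F N) (chiFixed29 F N ν ε₁)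
  (fun K _ k => domAltOfRecord F N ν K k)`).
* §3 AT THE STAGE-13 RECORD, run by run: ★★ `thm3Member_forall_stage13SepCoPH_atDomAlt_of_geometricChartData` (the `∀ P` shape of FILE 5's door) and ★★
  `b12_main_forall_stage13SepCoPH_atDomAlt_of_geometricChartData` (`∀ P, Dag.B12_main (leavesP w P)` given the run-indexed leaf `h12`).

HONEST SCOPE.  As FILE 5.  The proviso of §2 is at the ALTERNATIVE domains `domAltOfRecord` (the β-slot χ's domains of the N09 doors), not at def-R's first-form `domOfRecord`
of `Stage8Params.HasContTransportAlongDom29` (whose domains read the minimiser `U_{k+1}(W)`; relating the two is [B11] Thm 1 ∕ Prop 2 [12] bookkeeping, not done here).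
-/

noncomputable section

open MeasureTheory Set Filter Topology
open scoped ENNReal NNReal
open Literature.MathematicalPhysics.QuantumFieldTheory
open Literature.MathematicalPhysics.QuantumFieldTheory.Balaban1983to89
open Literature.MathematicalPhysics.QuantumFieldTheory.Balaban1983to89.Node00
open Literature.MathematicalPhysics.QuantumFieldTheory.Balaban1983to89.T4Continuum (T4Family)
open Literature.MathematicalPhysics.QuantumFieldTheory.Balaban1983to89.DagBinding (WorldP leavesP)
open Literature.MathematicalPhysics.QuantumFieldTheory.Balaban1983to89.B12RTGaugeInvariance254 (liftTransf)
open Literature.MathematicalPhysics.QuantumFieldTheory.Balaban1983to89.GaugeField (gaugeAct)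
open Literature.MathematicalPhysics.QuantumFieldTheory.Balaban1983to89.ExpMeanLog (deltaSU)
open Literature.MathematicalPhysics.QuantumFieldTheory.Balaban1983to89.FederbushMean (deltaFed)
open Literature.MathematicalPhysics.QuantumFieldTheory.Balaban1983to89.B12NodeKnitRecord8 (b12_main_of_leaf_of_thm3Member)
open Summit.QuantumFields.YangMills.BalabanUVNodes.N09RegularityTowerOfGeometricChartData

namespace Summit.QuantumFields.YangMills.BalabanUVNodes.N09OnDomainProvisoOfGeometricChartData

variable {F : T4Family} {N : ℕ} [NeZero N]

/-! ## §1 Per torus and history: K0e's one-density on-domain proviso at every step -/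

section PerTorus

variable (ν : Stage7Numerics) {ε₁ : ℝ} (K : ℕ) (g : ℕ → ℝ)
  {Z : ℕ → Type*} [∀ j, TopologicalSpace (Z j)] [∀ j, MeasurableSpace (Z j)] (τ : ∀ j, Measure (Z j)) [∀ j, SFinite (τ j)] [∀ j, (τ j).IsOpenPosMeasure]
  (Φ : ∀ j, (PBond (F.P K) (j + 1) → SU N) × Z j → GaugeField (F.P K) j (SU N))
  (J : ∀ j, (PBond (F.P K) (j + 1) → SU N) × Z j → ℝ≥0)
  (z₀ : ∀ j, (PBond (F.P K) (j + 1) → SU N) → Z j)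

/-- **★★ THE ON-DOMAIN β-VERSION PROVISO AT EVERY STEP OF A TORUS, FROM GEOMETRIC CHART DATA**: for every `j < K` the transform of record of the β-input `ρ_j` HAS A VERSION
CONTINUOUS ON `domAltOfRecord ν K (j+1)` (K0e's `Node00.HasContTransportOn`; the canonical version restricted to the domain, FILE 5's `hreg_j` + `hasContVersionOn_regSet`).
[cite: Balaban1987RG1, (0.13) p.254, p.259 and (2.10) p.267] -/
theorem hasContTransportOn_all_of_geometricChartData (hε : 0 < ε₁) (hε₀ : 0 ≤ ν.ε₀)
    (hnumF : ((((F.P K).d * (F.P K).L : ℕ) : ℝ)) ^ 2 / 4 * ν.ε₀ < deltaFed (Fin N))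
    (hsolν : ∀ j < K, ∀ W ∈ domAltOfRecord F N ν K (j + 1), UkExists F N K (j + 1) ν.εreg W)
    (hint : ∀ j < K, Integrable (betaInputOfRecord F N (TcanOfRecord F N) (chiFixed29 F N ν ε₁) K g j) (fieldMeasure (F.P K) j (SU N)))
    (hΦ : ∀ j, Measurable (Φ j)) (hJ : ∀ j, Measurable (J j))
    (havgΦ : ∀ j < K, ∀ V ∈ domAltOfRecord F N ν K (j + 1), ∀ z, (avOfRecord F N K j).avg (Φ j (V, z)) = V)
    (hmap : ∀ j < K, (fieldMeasure (F.P K) j (SU N)).restrict ((avOfRecord F N K j).avg ⁻¹' domAltOfRecord F N ν K (j + 1) ∩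
        {U | chiFixed29 F N ν ε₁ K g j U ≠ 0})
      = ((((piHaar (F.P K) (j + 1) (SU N)).restrict (domAltOfRecord F N ν K (j + 1))).prod (τ j)).withDensity (fun p => (J j p : ℝ≥0∞))).map (Φ j))
    (hconf : ∀ j < K, ∀ V₀ ∈ domAltOfRecord F N ν K (j + 1), ∃ C ⊆ domAltOfRecord F N ν K j, IsCompact C ∧ ∃ bound : Z j → ℝ, Integrable bound (τ j) ∧
      ∀ᶠ V in 𝓝[domAltOfRecord F N ν K (j + 1)] V₀, ∀ᵐ z ∂(τ j), (J j (V, z) : ℝ) ≤ bound z ∧ Φ j (V, z) ∈ C)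
    (hΦV : ∀ j < K, ∀ V₀ ∈ domAltOfRecord F N ν K (j + 1), ∀ᵐ z ∂(τ j), ContinuousWithinAt (fun V => Φ j (V, z)) (domAltOfRecord F N ν K (j + 1)) V₀)
    (hJV : ∀ j < K, ∀ V₀ ∈ domAltOfRecord F N ν K (j + 1), ∀ᵐ z ∂(τ j), ContinuousWithinAt (fun V => (J j (V, z) : ℝ)) (domAltOfRecord F N ν K (j + 1)) V₀)
    (hcrit : ∀ j < K, ContinuousOn (critCfgOfRecord F N ν K j) (domAltOfRecord F N ν K (j + 1)))
    (hnull : ∀ j < K, ∀ V₀ ∈ domAltOfRecord F N ν K (j + 1), ∀ b : PBond (F.P K) j, ¬ IsB0 b →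
      τ j {z | fluctDevOfRecord F N ν K j (Φ j (V₀, z)) b = ε₁} = 0)
    (hz₀ : ∀ j < K, ∀ V ∈ domAltOfRecord F N ν K (j + 1), Φ j (V, z₀ j V) = critCfgOfRecord F N ν K j V)
    (hΦc : ∀ j < K, ∀ V ∈ domAltOfRecord F N ν K (j + 1), ContinuousAt (fun z => Φ j (V, z)) (z₀ j V))
    (hJpos : ∀ j < K, ∀ V ∈ domAltOfRecord F N ν K (j + 1), ∀ᶠ z in 𝓝 (z₀ j V), 0 < J j (V, z)) :
    ∀ j < K, HasContTransportOn F N K j (betaInputOfRecord F N (TcanOfRecord F N) (chiFixed29 F N ν ε₁) K g j) (domAltOfRecord F N ν K (j + 1)) := by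
  intro j hj
  haveI := isOpenPosMeasure_piHaar_SUN N (F.P K) (j + 1)
  exact hasContVersionOn_regSet.mono
    (hreg_pos_all_of_geometricChartData ν K g τ Φ J z₀ hε hε₀ hnumF hsolν hint hΦ hJ havgΦ hmap hconf hΦV hJV hcrit hnull hz₀ hΦc hJpos j hj).1

end PerTorus

/-! ## §2 Chart data for every torus and history: K0e's χ-generic on-domain proviso at `(TcanOfRecord, χ^{(2.9)}, domAlt)` -/

section AllTori

variable (ν : Stage7Numerics) {ε₁ : ℝ}
  {Z : ℕ → (ℕ → ℝ) → ℕ → Type*} [∀ K g j, TopologicalSpace (Z K g j)] [∀ K g j, MeasurableSpace (Z K g j)]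
  (τ : ∀ K g j, Measure (Z K g j)) [∀ K g j, SFinite (τ K g j)] [∀ K g j, (τ K g j).IsOpenPosMeasure]
  (Φ : ∀ K g j, (PBond (F.P K) (j + 1) → SU N) × Z K g j → GaugeField (F.P K) j (SU N))
  (J : ∀ K g j, (PBond (F.P K) (j + 1) → SU N) × Z K g j → ℝ≥0)
  (z₀ : ∀ K g j, (PBond (F.P K) (j + 1) → SU N) → Z K g j)

/-- **★★★ K0e's (2.9)-KEYED ON-DOMAIN β-VERSION PROVISO AT THE RECORD's SMALL-FIELD DOMAINS, FROM GEOMETRIC CHART DATA FOR EVERY TORUS AND HISTORY**: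
`HasContTransportAlongOnχ F N (TcanOfRecord F N) (chiFixed29 F N ν ε₁) (fun K _ k => domAltOfRecord F N ν K k)` — «at every torus `K`, history `g` and step `k < K` the
β-input `χ^{(2.9)}_k·exp[−GF_k∕g_k² + A_k]` has a transform of record with a version continuous ON `domAlt_{k+1}`» (`Node00.SmallFieldChi29OfRecord` §4) — from, for every
`(K, g, j)`, [I]'s (2.10)-shaped chart of the averaging of record over `domAlt_{j+1}` through the critical configuration with A-free regularity (DISPLAYED), N07's `hcrit` ∕
`hsolν`, (I19) `hint`, and the numerics `0 < ε₁`, `0 ≤ ν.ε₀`, `((d·L)²∕4)·ν.ε₀ < δ_N`.  The (F1) programme's target in hypothesis form; nothing of Bałaban's asserted.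
[cite: Balaban1987RG1, (0.13) p.254, (0.19) p.255, p.259, (2.9) p.266 and (2.10) p.267] -/
theorem hasContTransportAlongOnχ_domAlt_of_geometricChartData (hε : 0 < ε₁) (hε₀ : 0 ≤ ν.ε₀)
    (hnumF : ∀ K, ((((F.P K).d * (F.P K).L : ℕ) : ℝ)) ^ 2 / 4 * ν.ε₀ < deltaFed (Fin N))
    (hsolν : ∀ K, ∀ j < K, ∀ W ∈ domAltOfRecord F N ν K (j + 1), UkExists F N K (j + 1) ν.εreg W)
    (hint : ∀ K (g : ℕ → ℝ), ∀ j < K, Integrable (betaInputOfRecord F N (TcanOfRecord F N) (chiFixed29 F N ν ε₁) K g j) (fieldMeasure (F.P K) j (SU N)))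
    (hΦ : ∀ K g j, Measurable (Φ K g j)) (hJ : ∀ K g j, Measurable (J K g j))
    (havgΦ : ∀ K g, ∀ j < K, ∀ V ∈ domAltOfRecord F N ν K (j + 1), ∀ z, (avOfRecord F N K j).avg (Φ K g j (V, z)) = V)
    (hmap : ∀ K g, ∀ j < K, (fieldMeasure (F.P K) j (SU N)).restrict ((avOfRecord F N K j).avg ⁻¹' domAltOfRecord F N ν K (j + 1) ∩
        {U | chiFixed29 F N ν ε₁ K g j U ≠ 0})
      = ((((piHaar (F.P K) (j + 1) (SU N)).restrict (domAltOfRecord F N ν K (j + 1))).prod (τ K g j)).withDensity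
          (fun p => (J K g j p : ℝ≥0∞))).map (Φ K g j))
    (hconf : ∀ K g, ∀ j < K, ∀ V₀ ∈ domAltOfRecord F N ν K (j + 1), ∃ C ⊆ domAltOfRecord F N ν K j, IsCompact C ∧ ∃ bound : Z K g j → ℝ,
      Integrable bound (τ K g j) ∧
        ∀ᶠ V in 𝓝[domAltOfRecord F N ν K (j + 1)] V₀, ∀ᵐ z ∂(τ K g j), (J K g j (V, z) : ℝ) ≤ bound z ∧ Φ K g j (V, z) ∈ C)
    (hΦV : ∀ K g, ∀ j < K, ∀ V₀ ∈ domAltOfRecord F N ν K (j + 1), ∀ᵐ z ∂(τ K g j),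
      ContinuousWithinAt (fun V => Φ K g j (V, z)) (domAltOfRecord F N ν K (j + 1)) V₀)
    (hJV : ∀ K g, ∀ j < K, ∀ V₀ ∈ domAltOfRecord F N ν K (j + 1), ∀ᵐ z ∂(τ K g j),
      ContinuousWithinAt (fun V => (J K g j (V, z) : ℝ)) (domAltOfRecord F N ν K (j + 1)) V₀)
    (hcrit : ∀ K, ∀ j < K, ContinuousOn (critCfgOfRecord F N ν K j) (domAltOfRecord F N ν K (j + 1)))
    (hnull : ∀ K g, ∀ j < K, ∀ V₀ ∈ domAltOfRecord F N ν K (j + 1), ∀ b : PBond (F.P K) j, ¬ IsB0 b →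
      τ K g j {z | fluctDevOfRecord F N ν K j (Φ K g j (V₀, z)) b = ε₁} = 0)
    (hz₀ : ∀ K g, ∀ j < K, ∀ V ∈ domAltOfRecord F N ν K (j + 1), Φ K g j (V, z₀ K g j V) = critCfgOfRecord F N ν K j V)
    (hΦc : ∀ K g, ∀ j < K, ∀ V ∈ domAltOfRecord F N ν K (j + 1), ContinuousAt (fun z => Φ K g j (V, z)) (z₀ K g j V))
    (hJpos : ∀ K g, ∀ j < K, ∀ V ∈ domAltOfRecord F N ν K (j + 1), ∀ᶠ z in 𝓝 (z₀ K g j V), 0 < J K g j (V, z)) :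
    HasContTransportAlongOnχ F N (TcanOfRecord F N) (chiFixed29 F N ν ε₁) (fun K _ k => domAltOfRecord F N ν K k) := by
  intro K g k hk
  exact hasContTransportOn_all_of_geometricChartData ν K g (τ K g) (Φ K g) (J K g) (z₀ K g) hε hε₀ (hnumF K) (hsolν K) (hint K g)
    (hΦ K g) (hJ K g) (havgΦ K g) (hmap K g) (hconf K g) (hΦV K g) (hJV K g) (hcrit K) (hnull K g) (hz₀ K g) (hΦc K g) (hJpos K g) k hk

end AllTori

/-! ## §3 At the Stage-13 record, run by run: the `∀ P` doors on geometric chart data -/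

section Forall

variable (θ : Stage13HParams F N) (h : θ.Provisos₁₃SepCoPH F N) {w : WorldP}
  {Z : B12.RunParams → ℕ → Type*} [∀ P j, TopologicalSpace (Z P j)] [∀ P j, MeasurableSpace (Z P j)]
  (τ : ∀ P j, Measure (Z P j)) [∀ P j, SFinite (τ P j)] [∀ P j, (τ P j).IsOpenPosMeasure]
  (Φ : ∀ (P : B12.RunParams) j, (PBond (F.P P.K) (j + 1) → SU N) × Z P j → GaugeField (F.P P.K) j (SU N))
  (J : ∀ (P : B12.RunParams) j, (PBond (F.P P.K) (j + 1) → SU N) × Z P j → ℝ≥0)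
  (z₀ : ∀ (P : B12.RunParams) j, (PBond (F.P P.K) (j + 1) → SU N) → Z P j)

/-- **★★ THE `∀ P` SHAPE OF FILE 5's DOOR** (dag-n24-c's supplier type `∀ P, smallCouplings → smallFieldInductive`): per run, FILE 5's
`thm3Member_stage13SepCoPH_atDomAlt_of_geometricChartData_of_numerics_of_εreg_eq` with run-indexed chart data and run-indexed numerics.  CONDITIONAL; N09 NOT discharged.
[cite: Balaban1987RG1, Thm 3 p.264, p.259, (0.11) p.253, (0.19) p.255, (2.9) p.266, (2.10) p.267; Balaban1985Variational, Thm 1 (8)–(10) p.279 and (181) p.307] -/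
theorem thm3Member_forall_stage13SepCoPH_atDomAlt_of_geometricChartData
    (hC : w.C = (datumOfRecord₁₃SepCoPH F N θ h).C) (hε : 0 < θ.ε₂₉) (heq : θ.toStage13Params.ν.εreg = θ.εbg)
    (hεreg : 0 < θ.toStage13Params.ν.εreg) (hε₀ : 0 ≤ θ.toStage13Params.ν.ε₀)
    (hnumF : ∀ P : B12.RunParams, ((((F.P P.K).d * (F.P P.K).L : ℕ) : ℝ)) ^ 2 / 4 * θ.toStage13Params.ν.ε₀ < deltaFed (Fin N))
    (hε3 : ∀ P : B12.RunParams, (143 * (((((F.P P.K).d + 4 : ℕ) : ℝ)) ^ 2 / 4) ^ 2) * θ.toStage13Params.ν.εreg ≤ 1 / 3)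
    (hε2 : ∀ P : B12.RunParams, 2 * θ.toStage13Params.ν.εreg ≤ 2 * deltaSU (Fin N) / ((((F.P P.K).d + 4) * (F.P P.K).L : ℕ) : ℝ) ^ 2)
    (hord : ∀ P : B12.RunParams, 2 * θ.toStage13Params.ν.εreg / ((F.P P.K).L : ℝ) ^ 2 +
      4 * max θ.toStage13Params.ε₂₉ (10 * (((((F.P P.K).d + 2) * (F.P P.K).L : ℕ) : ℝ) * θ.toStage13Params.ε₂₉) * ((F.P P.K).L : ℝ) ^ ((F.P P.K).d - 1)) ≤
        θ.toStage13Params.ν.ε₀)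
    (hn1 : ∀ P : B12.RunParams, 1640 * (2 * (((((F.P P.K).d + 2) * (F.P P.K).L : ℕ) : ℝ) * θ.toStage13Params.ε₂₉) +
        ((((F.P P.K).d + 2) * (F.P P.K).L : ℕ) : ℝ) ^ 2 / 4 * (2 * θ.toStage13Params.ν.εreg / ((F.P P.K).L : ℝ) ^ 2)) *
          (((F.P P.K).L : ℝ) ^ ((F.P P.K).d - 1)) ^ 2 ≤ 1)
    (hn2 : ∀ P : B12.RunParams, 13 * (2 * (((((F.P P.K).d + 2) * (F.P P.K).L : ℕ) : ℝ) * θ.toStage13Params.ε₂₉) +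
        ((((F.P P.K).d + 2) * (F.P P.K).L : ℕ) : ℝ) ^ 2 / 4 * (2 * θ.toStage13Params.ν.εreg / ((F.P P.K).L : ℝ) ^ 2)) *
          ((F.P P.K).L : ℝ) ^ ((F.P P.K).d - 1) < deltaSU (Fin N))
    (hcov : ∀ (P : B12.RunParams), ∀ j < P.K, ∀ (v : GaugeTransf (F.P P.K) (j + 1) (SU N)) (W : GaugeField (F.P P.K) (j + 1) (SU N)),
      UkExists F N P.K (j + 1) θ.toStage13Params.ν.εreg W →
        critCfgOfRecord F N θ.toStage13Params.ν P.K j (gaugeAct v W) = gaugeAct (liftTransf v) (critCfgOfRecord F N θ.toStage13Params.ν P.K j W))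
    (hsolν : ∀ (P : B12.RunParams), ∀ j < P.K, ∀ W ∈ domAltOfRecord F N θ.ν P.K (j + 1), UkExists F N P.K (j + 1) θ.toStage13Params.ν.εreg W)
    (hint : ∀ (P : B12.RunParams), ∀ j < P.K, Integrable (betaInputOfRecord F N (TβOfRecord₁₃ F N) (chiβOfRecord₁₃ F N θ.toStage13Params) P.K
      (gOfRecord₁₃ F N θ.toStage13Params P) j) (fieldMeasure (F.P P.K) j (SU N)))
    (hΦ : ∀ P j, Measurable (Φ P j)) (hJ : ∀ P j, Measurable (J P j))
    (havgΦ : ∀ (P : B12.RunParams), ∀ j < P.K, ∀ V ∈ domAltOfRecord F N θ.ν P.K (j + 1), ∀ z, (avOfRecord F N P.K j).avg (Φ P j (V, z)) = V)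
    (hmap : ∀ (P : B12.RunParams), ∀ j < P.K, (fieldMeasure (F.P P.K) j (SU N)).restrict ((avOfRecord F N P.K j).avg ⁻¹' domAltOfRecord F N θ.ν P.K (j + 1) ∩
        {U | chiβOfRecord₁₃ F N θ.toStage13Params P.K (gOfRecord₁₃ F N θ.toStage13Params P) j U ≠ 0})
      = ((((piHaar (F.P P.K) (j + 1) (SU N)).restrict (domAltOfRecord F N θ.ν P.K (j + 1))).prod (τ P j)).withDensity
          (fun p => (J P j p : ℝ≥0∞))).map (Φ P j))
    (hconf : ∀ (P : B12.RunParams), ∀ j < P.K, ∀ V₀ ∈ domAltOfRecord F N θ.ν P.K (j + 1), ∃ C ⊆ domAltOfRecord F N θ.ν P.K j, IsCompact C ∧ ∃ bound : Z P j → ℝ,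
      Integrable bound (τ P j) ∧
        ∀ᶠ V in 𝓝[domAltOfRecord F N θ.ν P.K (j + 1)] V₀, ∀ᵐ z ∂(τ P j), (J P j (V, z) : ℝ) ≤ bound z ∧ Φ P j (V, z) ∈ C)
    (hΦV : ∀ (P : B12.RunParams), ∀ j < P.K, ∀ V₀ ∈ domAltOfRecord F N θ.ν P.K (j + 1), ∀ᵐ z ∂(τ P j),
      ContinuousWithinAt (fun V => Φ P j (V, z)) (domAltOfRecord F N θ.ν P.K (j + 1)) V₀)
    (hJV : ∀ (P : B12.RunParams), ∀ j < P.K, ∀ V₀ ∈ domAltOfRecord F N θ.ν P.K (j + 1), ∀ᵐ z ∂(τ P j),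
      ContinuousWithinAt (fun V => (J P j (V, z) : ℝ)) (domAltOfRecord F N θ.ν P.K (j + 1)) V₀)
    (hcrit : ∀ (P : B12.RunParams), ∀ j < P.K, ContinuousOn (critCfgOfRecord F N θ.toStage13Params.ν P.K j) (domAltOfRecord F N θ.ν P.K (j + 1)))
    (hnull : ∀ (P : B12.RunParams), ∀ j < P.K, ∀ V₀ ∈ domAltOfRecord F N θ.ν P.K (j + 1), ∀ b : PBond (F.P P.K) j, ¬ IsB0 b →
      τ P j {z | fluctDevOfRecord F N θ.toStage13Params.ν P.K j (Φ P j (V₀, z)) b = θ.toStage13Params.ε₂₉} = 0)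
    (hz₀ : ∀ (P : B12.RunParams), ∀ j < P.K, ∀ V ∈ domAltOfRecord F N θ.ν P.K (j + 1), Φ P j (V, z₀ P j V) = critCfgOfRecord F N θ.toStage13Params.ν P.K j V)
    (hΦc : ∀ (P : B12.RunParams), ∀ j < P.K, ∀ V ∈ domAltOfRecord F N θ.ν P.K (j + 1), ContinuousAt (fun z => Φ P j (V, z)) (z₀ P j V))
    (hJpos : ∀ (P : B12.RunParams), ∀ j < P.K, ∀ V ∈ domAltOfRecord F N θ.ν P.K (j + 1), ∀ᶠ z in 𝓝 (z₀ P j V), 0 < J P j (V, z))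
    (h11 : ∀ (P : B12.RunParams) (k : ℕ), k ≤ P.K → ∀ V ∈ domAltOfRecord F N θ.ν P.K k, UkExists F N P.K k θ.εbg V ∧ UniqueUkOrbit F N P.K k θ.εbg V)
    (hres : ∀ (P : B12.RunParams) (k : ℕ), k ≤ P.K → HRestrict F N θ.εbg P.K k (domAltOfRecord F N θ.ν P.K k))
    (huniq : ∀ (P : B12.RunParams) (k : ℕ), k ≤ P.K → ∀ V ∈ domAltOfRecord F N θ.ν P.K k, ∀ j < k,
      UniqueUkOrbit F N P.K (j + 1) θ.εbg (Averaging.iter (avOfRecord F N P.K) (j + 1) (Uk F N P.K k θ.εbg V))) :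
    ∀ P : B12.RunParams, (leavesP w P).smallCouplings → (leavesP w P).smallFieldInductive :=
  fun P => thm3Member_stage13SepCoPH_atDomAlt_of_geometricChartData_of_numerics_of_εreg_eq θ h P (τ P) (Φ P) (J P) (z₀ P) hC hε heq hεreg hε₀
    (hnumF P) (hε3 P) (hε2 P) (hord P) (hn1 P) (hn2 P) (hcov P) (hsolν P) (hint P) (hΦ P) (hJ P) (havgΦ P) (hmap P) (hconf P) (hΦV P) (hJV P)
    (hcrit P) (hnull P) (hz₀ P) (hΦc P) (hJpos P) (h11 P) (hres P) (huniq P)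

/-- **★★ … AND N09 AT EVERY RUN WITH ITS OWN LEAF**: given the run-indexed leaf `h12 : ∀ P, (leavesP w P).b12` ([I] Lemma 4), `∀ P, Dag.B12_main (leavesP w P)`
(`B12NodeKnitRecord8.b12_main_of_leaf_of_thm3Member`).  CONDITIONAL; N09 NOT discharged. [cite: Balaban1987RG1, Lemma 4 (3.53) p.280, Thm 3 p.264 and (2.10) p.267] -/
theorem b12_main_forall_stage13SepCoPH_atDomAlt_of_geometricChartData
    (hC : w.C = (datumOfRecord₁₃SepCoPH F N θ h).C) (h12 : ∀ P : B12.RunParams, (leavesP w P).b12)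
    (hε : 0 < θ.ε₂₉) (heq : θ.toStage13Params.ν.εreg = θ.εbg)
    (hεreg : 0 < θ.toStage13Params.ν.εreg) (hε₀ : 0 ≤ θ.toStage13Params.ν.ε₀)
    (hnumF : ∀ P : B12.RunParams, ((((F.P P.K).d * (F.P P.K).L : ℕ) : ℝ)) ^ 2 / 4 * θ.toStage13Params.ν.ε₀ < deltaFed (Fin N))
    (hε3 : ∀ P : B12.RunParams, (143 * (((((F.P P.K).d + 4 : ℕ) : ℝ)) ^ 2 / 4) ^ 2) * θ.toStage13Params.ν.εreg ≤ 1 / 3)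
    (hε2 : ∀ P : B12.RunParams, 2 * θ.toStage13Params.ν.εreg ≤ 2 * deltaSU (Fin N) / ((((F.P P.K).d + 4) * (F.P P.K).L : ℕ) : ℝ) ^ 2)
    (hord : ∀ P : B12.RunParams, 2 * θ.toStage13Params.ν.εreg / ((F.P P.K).L : ℝ) ^ 2 +
      4 * max θ.toStage13Params.ε₂₉ (10 * (((((F.P P.K).d + 2) * (F.P P.K).L : ℕ) : ℝ) * θ.toStage13Params.ε₂₉) * ((F.P P.K).L : ℝ) ^ ((F.P P.K).d - 1)) ≤
        θ.toStage13Params.ν.ε₀)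
    (hn1 : ∀ P : B12.RunParams, 1640 * (2 * (((((F.P P.K).d + 2) * (F.P P.K).L : ℕ) : ℝ) * θ.toStage13Params.ε₂₉) +
        ((((F.P P.K).d + 2) * (F.P P.K).L : ℕ) : ℝ) ^ 2 / 4 * (2 * θ.toStage13Params.ν.εreg / ((F.P P.K).L : ℝ) ^ 2)) *
          (((F.P P.K).L : ℝ) ^ ((F.P P.K).d - 1)) ^ 2 ≤ 1)
    (hn2 : ∀ P : B12.RunParams, 13 * (2 * (((((F.P P.K).d + 2) * (F.P P.K).L : ℕ) : ℝ) * θ.toStage13Params.ε₂₉) +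
        ((((F.P P.K).d + 2) * (F.P P.K).L : ℕ) : ℝ) ^ 2 / 4 * (2 * θ.toStage13Params.ν.εreg / ((F.P P.K).L : ℝ) ^ 2)) *
          ((F.P P.K).L : ℝ) ^ ((F.P P.K).d - 1) < deltaSU (Fin N))
    (hcov : ∀ (P : B12.RunParams), ∀ j < P.K, ∀ (v : GaugeTransf (F.P P.K) (j + 1) (SU N)) (W : GaugeField (F.P P.K) (j + 1) (SU N)),
      UkExists F N P.K (j + 1) θ.toStage13Params.ν.εreg W →
        critCfgOfRecord F N θ.toStage13Params.ν P.K j (gaugeAct v W) = gaugeAct (liftTransf v) (critCfgOfRecord F N θ.toStage13Params.ν P.K j W))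
    (hsolν : ∀ (P : B12.RunParams), ∀ j < P.K, ∀ W ∈ domAltOfRecord F N θ.ν P.K (j + 1), UkExists F N P.K (j + 1) θ.toStage13Params.ν.εreg W)
    (hint : ∀ (P : B12.RunParams), ∀ j < P.K, Integrable (betaInputOfRecord F N (TβOfRecord₁₃ F N) (chiβOfRecord₁₃ F N θ.toStage13Params) P.K
      (gOfRecord₁₃ F N θ.toStage13Params P) j) (fieldMeasure (F.P P.K) j (SU N)))
    (hΦ : ∀ P j, Measurable (Φ P j)) (hJ : ∀ P j, Measurable (J P j))
    (havgΦ : ∀ (P : B12.RunParams), ∀ j < P.K, ∀ V ∈ domAltOfRecord F N θ.ν P.K (j + 1), ∀ z, (avOfRecord F N P.K j).avg (Φ P j (V, z)) = V)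
    (hmap : ∀ (P : B12.RunParams), ∀ j < P.K, (fieldMeasure (F.P P.K) j (SU N)).restrict ((avOfRecord F N P.K j).avg ⁻¹' domAltOfRecord F N θ.ν P.K (j + 1) ∩
        {U | chiβOfRecord₁₃ F N θ.toStage13Params P.K (gOfRecord₁₃ F N θ.toStage13Params P) j U ≠ 0})
      = ((((piHaar (F.P P.K) (j + 1) (SU N)).restrict (domAltOfRecord F N θ.ν P.K (j + 1))).prod (τ P j)).withDensity
          (fun p => (J P j p : ℝ≥0∞))).map (Φ P j))
    (hconf : ∀ (P : B12.RunParams), ∀ j < P.K, ∀ V₀ ∈ domAltOfRecord F N θ.ν P.K (j + 1), ∃ C ⊆ domAltOfRecord F N θ.ν P.K j, IsCompact C ∧ ∃ bound : Z P j → ℝ,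
      Integrable bound (τ P j) ∧
        ∀ᶠ V in 𝓝[domAltOfRecord F N θ.ν P.K (j + 1)] V₀, ∀ᵐ z ∂(τ P j), (J P j (V, z) : ℝ) ≤ bound z ∧ Φ P j (V, z) ∈ C)
    (hΦV : ∀ (P : B12.RunParams), ∀ j < P.K, ∀ V₀ ∈ domAltOfRecord F N θ.ν P.K (j + 1), ∀ᵐ z ∂(τ P j),
      ContinuousWithinAt (fun V => Φ P j (V, z)) (domAltOfRecord F N θ.ν P.K (j + 1)) V₀)
    (hJV : ∀ (P : B12.RunParams), ∀ j < P.K, ∀ V₀ ∈ domAltOfRecord F N θ.ν P.K (j + 1), ∀ᵐ z ∂(τ P j),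
      ContinuousWithinAt (fun V => (J P j (V, z) : ℝ)) (domAltOfRecord F N θ.ν P.K (j + 1)) V₀)
    (hcrit : ∀ (P : B12.RunParams), ∀ j < P.K, ContinuousOn (critCfgOfRecord F N θ.toStage13Params.ν P.K j) (domAltOfRecord F N θ.ν P.K (j + 1)))
    (hnull : ∀ (P : B12.RunParams), ∀ j < P.K, ∀ V₀ ∈ domAltOfRecord F N θ.ν P.K (j + 1), ∀ b : PBond (F.P P.K) j, ¬ IsB0 b →
      τ P j {z | fluctDevOfRecord F N θ.toStage13Params.ν P.K j (Φ P j (V₀, z)) b = θ.toStage13Params.ε₂₉} = 0)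
    (hz₀ : ∀ (P : B12.RunParams), ∀ j < P.K, ∀ V ∈ domAltOfRecord F N θ.ν P.K (j + 1), Φ P j (V, z₀ P j V) = critCfgOfRecord F N θ.toStage13Params.ν P.K j V)
    (hΦc : ∀ (P : B12.RunParams), ∀ j < P.K, ∀ V ∈ domAltOfRecord F N θ.ν P.K (j + 1), ContinuousAt (fun z => Φ P j (V, z)) (z₀ P j V))
    (hJpos : ∀ (P : B12.RunParams), ∀ j < P.K, ∀ V ∈ domAltOfRecord F N θ.ν P.K (j + 1), ∀ᶠ z in 𝓝 (z₀ P j V), 0 < J P j (V, z))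
    (h11 : ∀ (P : B12.RunParams) (k : ℕ), k ≤ P.K → ∀ V ∈ domAltOfRecord F N θ.ν P.K k, UkExists F N P.K k θ.εbg V ∧ UniqueUkOrbit F N P.K k θ.εbg V)
    (hres : ∀ (P : B12.RunParams) (k : ℕ), k ≤ P.K → HRestrict F N θ.εbg P.K k (domAltOfRecord F N θ.ν P.K k))
    (huniq : ∀ (P : B12.RunParams) (k : ℕ), k ≤ P.K → ∀ V ∈ domAltOfRecord F N θ.ν P.K k, ∀ j < k,
      UniqueUkOrbit F N P.K (j + 1) θ.εbg (Averaging.iter (avOfRecord F N P.K) (j + 1) (Uk F N P.K k θ.εbg V))) :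
    ∀ P : B12.RunParams, Dag.B12_main (leavesP w P) :=
  fun P => b12_main_of_leaf_of_thm3Member (h12 P)
    (thm3Member_forall_stage13SepCoPH_atDomAlt_of_geometricChartData θ h τ Φ J z₀ hC hε heq hεreg hε₀ hnumF hε3 hε2 hord hn1 hn2 hcov hsolν hint hΦ hJ havgΦ hmap
      hconf hΦV hJV hcrit hnull hz₀ hΦc hJpos h11 hres huniq P)

end Forall

end Summit.QuantumFields.YangMills.BalabanUVNodes.N09OnDomainProvisoOfGeometricChartData

end
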